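import Summits.ResolutionOfSingularities.ResolutionOfSingularities.Theorems.RestrictCutKernels
import HarnessLib

/-!
# RestrictCutKernels2 — decomp-res node «RestrictCut» (lens-4 g34, critic row 194 CLEARED (NP-R) DECIDED +1 · MAP
0), tree file 2/4 of the node

Content VERBATIM from the decomp-res lens-4 g34 node `HOME/decomp-res-lens-4/g34/RestrictCut.lean` (pin bc9b1075; no
carry, imports the landed tree only); HOME = run/shared/lean/pub/decomp-res; critic row 194 CLEARED (NP-R) DECIDED
+1 · MAP 0; landing orders INBOX :1128/:1135 — provenance, critic text and the lens header in full in the first file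
of the node, `RestrictCutKernels`.  Namespace `…Theorems.HugValuationCut`; `--supports stmt-ResolutionOfSingularities-28338`.

## This file

Continuation 2/2 of `RestrictCutKernels` (same sections of the node, cut at the 400-line cap): carries
`divisorialTower_of_coheight_eq_one`, `coheight_ne_one_of_not_divisorialTower`, `exists_rootOpens_one_lt_coheight`,
`noTower_nonDivisorial_threefold`, `divisorialTower_of_threefoldTower`, `noTowerWild_nonDivisorial_threefold`,
`noTowerWild_occultNonDivisorial_threefold`.

[WRITER NOTE (decomp-res writer g12): file split only (tree files ≤ 400 lines); namespace, sections, section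
variables / universes / opens and every declaration exactly as in the lens (the node's file-level
dupNamespace-linter line is dropped — the library sets it; the `open …Theses` line lives only in the Theses-cone
file `MaxContactCutRestrictCut`); ONE dedup token change in `RestrictCutKernels`: the lens's 3-line folklore lemma
`stalkIdeal_bot_eq` restates the LANDED `TrackC.stalkIdeal_bot`
(`Theorems/WeightedInvariantLocalWeightedDropTrackCForward`, landed the same morning by another hand; pre-flight
`dedup.landed`) — the copy is DELETED, that module imported, and its one use in §107 cites `TrackC.stalkIdeal_bot`.]

(Sources: Hironaka1964 Ch. III; Giraud1975; Kollar2007 3.58–3.60; CossartJannsenSaito2020 Thm. 6.40, Ch. 8;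
Hauser2010Kangaroo; HauserPerlega2019 §2; CossartPiltant2008 §2; deJong1996 (alterations); Hironaka2005 (numerical
exponent, three key theorems); EGAIV4 §16, §21 (divisors); Matsumura1987 §20 (UFD), §28; StacksProject 0804 / 0BIQ /
031I / 0AFT.)
-/

noncomputable section

open CategoryTheory AlgebraicGeometry IsLocalRing TopologicalSpace
open Literature.AlgebraicGeometry.Resolution
open Summit.ResolutionOfSingularities.ResolutionOfSingularities.Theorems
open WeakOrderReduction ForcedTowerClasses DivergentTowerClasses MonomialTowerClasses
open HugDimensionClasses HugDimensionKernels SurfaceShadowClasses SurfaceShadowKernels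
open NearPointCut (SingularClass)
open Scheme.IdealSheafData (vanishingIdeal)
open scoped BigOperators

namespace Summit.ResolutionOfSingularities.ResolutionOfSingularities.Theorems.HugValuationCut

section DivisorialSteps

variable {k : Type} [Field k]

/-- **STEP A — A CODIMENSION-ONE POINT OF `V(𝓘_m)` GENERIZING TO THE MARKED POINT IS A DIVISORIAL FACTOR (PROVED; every
`p`, every field, every weight, every stage).**  See the section docstring: `(𝓘_m)_x = p · ((𝓘_m)_x : p)` in the UFD
`𝒪_{X_m,x_m}`, realised by the ideal sheaves `H = 𝓘(cl ζ)` and `K = (𝓘_m : H)`. [folklore] -/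
theorem divisorialTower_of_coheight_eq_one (T : ForcedTower) (g : T.St 0 ⟶ Spec (.of k)) (hB : IsBase (T.St 0) g)
    {n : ℕ} (hD : IsDatum n (T.D 0)) (m : ℕ) {ζ : T.St m} (hζ : ζ ∈ ((T.D m).ideal).support) (hsp : ζ ⤳ T.pt m)
    (h1 : Order.coheight ζ = 1) : DivisorialTower T := by
  obtain ⟨hN, hreg⟩ := tower_isLocallyNoetherian_isRegular T g hB m
  haveI := hN
  haveI : IsRegularLocalRing ((T.St m).presheaf.stalk (T.pt m)) := hreg (T.pt m)
  haveI : IsDomain ((T.St m).presheaf.stalk (T.pt m)) := isDomain_of_isRegularLocalRing _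
  haveI : UniqueFactorizationMonoid ((T.St m).presheaf.stalk (T.pt m)) := hreg.uniqueFactorizationMonoid_stalk (T.pt m)
  obtain ⟨p, -, hp⟩ := exists_prime_primeOfSpecializes_eq_span hsp h1
  -- the two ideal sheaves
  set I := (T.D m).ideal with hIdef
  set H := primeDivisorIdeal ζ with hHdef
  set K := colon I H with hKdef
  have hH : stalkIdeal H (T.pt m) = Ideal.span {p} := (stalkIdeal_primeDivisorIdeal hsp).trans hp
  have hIle : stalkIdeal I (T.pt m) ≤ stalkIdeal H (T.pt m) := by
    rw [hH, ← hp]; exact (mem_support_iff_stalkIdeal_le_primeOfSpecializes hsp I).mp hζ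
  have hK : stalkIdeal K (T.pt m) = Submodule.colon (stalkIdeal I (T.pt m)) (stalkIdeal H (T.pt m) : Set _) :=
    stalkIdeal_colon I H (T.pt m)
  have hfac : stalkIdeal I (T.pt m) = stalkIdeal H (T.pt m) * stalkIdeal K (T.pt m) := by
    rw [hK, hH]; exact (Ideal.span_singleton_mul_colon_of_le (hH ▸ hIle)).symm
  -- the orders are natural numbers, `a ≥ 1`
  have hordI : idealOrder I (T.pt m) = (n : ℕ∞) := tower_idealOrder_pt_eq T g hB hD m
  obtain ⟨a, ha⟩ := exists_nat_idealOrder_eq_of_stalkIdeal_le hordI hIle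
  obtain ⟨b, hb⟩ := exists_nat_idealOrder_eq_of_stalkIdeal_le hordI
    (show stalkIdeal I (T.pt m) ≤ stalkIdeal K (T.pt m) by rw [hfac]; exact Ideal.mul_le_left)
  have ha1 : 1 ≤ a := by
    have h := (one_le_idealOrder_iff H (T.pt m)).mpr ((mem_support_primeDivisorIdeal_iff ζ (T.pt m)).mpr hsp)
    rw [ha] at h
    exact_mod_cast h
  exact ⟨m, a, b, H, K, ⟨hfac, ha, hb⟩, ha1, hH ▸ inferInstance⟩

/-- **STEP A, contrapositive form used by the kill**: along a tower with NO divisorial factor, no codimension-one point of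
`V(𝓘_m)` generizes to the marked point `x_m`. [folklore] -/
theorem coheight_ne_one_of_not_divisorialTower (T : ForcedTower) (g : T.St 0 ⟶ Spec (.of k)) (hB : IsBase (T.St 0) g)
    {n : ℕ} (hD : IsDatum n (T.D 0)) (hnd : ¬ DivisorialTower T) (m : ℕ) {ζ : T.St m}
    (hζ : ζ ∈ ((T.D m).ideal).support) (hsp : ζ ⤳ T.pt m) : Order.coheight ζ ≠ 1 :=
  fun h1 => hnd (divisorialTower_of_coheight_eq_one T g hB hD m hζ hsp h1)

/-- **STEP B — AN ISOLATING ROOT OPEN (PROVED).**  If no codimension-one point of `V(𝓘_0)` generizes to `x_0`, some open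
`U₀ ∋ x_0` has `V(𝓘_0|U₀)` of codimension ≥ 2 at each of its points. [folklore] -/
theorem exists_rootOpens_one_lt_coheight (T : ForcedTower) (g : T.St 0 ⟶ Spec (.of k)) (hB : IsBase (T.St 0) g)
    {n : ℕ} (hD : IsDatum n (T.D 0))
    (hA : ∀ ζ ∈ ((T.D 0).ideal).support, ζ ⤳ T.pt 0 → Order.coheight ζ ≠ 1) :
    ∃ U₀ : (T.St 0).Opens, T.pt 0 ∈ U₀ ∧
      ∀ z ∈ (((T.D 0).ideal).comap U₀.ι).support, 1 < Order.coheight z := by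
  obtain ⟨hN, hreg⟩ := tower_isLocallyNoetherian_isRegular T g hB 0
  haveI := hN
  haveI : IsNoetherian (T.St 0) := tower_isNoetherian_root T g hB
  -- an integral Noetherian open neighbourhood `U₁` of `x_0`
  obtain ⟨U₁, hxU₁, hint⟩ := Hironaka2005.exists_opens_isIntegral hreg (T.pt 0)
  haveI := hint
  haveI : CompactSpace (U₁ : Scheme.{0}) :=
    isCompact_iff_compactSpace.mp (TopologicalSpace.NoetherianSpace.isCompact (U₁ : Set (T.St 0)))
  haveI : IsNoetherian (U₁ : Scheme.{0}) := {}
  set x₁ : (U₁ : Scheme.{0}) := ⟨T.pt 0, hxU₁⟩ with hx₁def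
  set I₁ := ((T.D 0).ideal).comap U₁.ι with hI₁def
  -- `I₁ ≠ ⊥`: its order at `x₁` is the weight `n < ∞`
  have hord₁ : idealOrder I₁ x₁ = (n : ℕ∞) := by
    rw [hI₁def, idealOrder_comap_of_isOpenImmersion]; exact tower_idealOrder_pt_eq T g hB hD 0
  have hI₁ : I₁ ≠ ⊥ := by
    intro h
    have hle : ((n + 1 : ℕ) : ℕ∞) ≤ idealOrder I₁ x₁ :=
      (le_idealOrder_iff I₁ x₁ (n + 1)).mpr (by rw [h, TrackC.stalkIdeal_bot]; exact bot_le)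
    rw [hord₁, Nat.cast_le] at hle
    omega
  -- the finitely many codimension-one points of `V(I₁)` and the closed union of their closures
  have hfin : (divisorialPoints I₁).Finite := finite_divisorialPoints hI₁
  set Z' : Set (U₁ : Scheme.{0}) := ⋃ ζ ∈ divisorialPoints I₁, closure {ζ} with hZ'def
  have hZ' : IsClosed Z' := hfin.isClosed_biUnion fun _ _ => isClosed_closure
  -- `x₁ ∉ Z'` by Step A
  have hxZ' : x₁ ∉ Z' := by
    intro h
    rw [hZ'def, Set.mem_iUnion₂] at h
    obtain ⟨ζ, hζ, hζx⟩ := h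
    have hsp : ζ ⤳ x₁ := specializes_iff_mem_closure.mpr hζx
    refine hA (U₁.ι.base ζ) ((mem_support_comap_iff _ U₁.ι ζ).mp hζ.1) (hsp.map U₁.ι.continuous) ?_
    rw [coheight_eq_of_isOpenImmersion]; exact hζ.2
  -- the root open `U₀ := U₁ ∖ Z'`
  set W : (U₁ : Scheme.{0}).Opens := ⟨Z'ᶜ, hZ'.isOpen_compl⟩ with hWdef
  refine ⟨U₁.ι ''ᵁ W, ?_, ?_⟩
  · exact (Scheme.Opens.mem_ι_image_iff (x := x₁)).mpr hxZ'
  · intro z hz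
    have hz0 : z.val ∈ ((T.D 0).ideal).support := (mem_support_comap_iff _ (U₁.ι ''ᵁ W).ι z).mp hz
    obtain ⟨w, hwW, hwz⟩ := (show z.val ∈ (U₁.ι.base '' (W : Set (U₁ : Scheme.{0}))) from z.2)
    have hwZ' : w ∉ Z' := hwW
    have hw : w ∈ I₁.support := by
      rw [hI₁def, mem_support_comap_iff, hwz]; exact hz0
    -- coheights: `coheight z = coheight z.val = coheight w`
    have e : Order.coheight z = Order.coheight w := by
      rw [← coheight_eq_of_isOpenImmersion (U₁.ι ''ᵁ W).ι, ← coheight_eq_of_isOpenImmersion U₁.ι]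
      exact congrArg Order.coheight hwz.symm
    rw [e]
    have h0 : Order.coheight w ≠ 0 := fun h =>
      not_mem_support_genericPoint hI₁ (eq_genericPoint_of_coheight_eq_zero h ▸ hw)
    have h1 : Order.coheight w ≠ 1 := fun h =>
      hwZ' (Set.mem_iUnion₂.mpr ⟨w, ⟨hw, h⟩, subset_closure (Set.mem_singleton w)⟩)
    exact lt_of_le_of_ne (Order.one_le_iff_ne_zero.mpr h0) (Ne.symm h1)

end DivisorialSteps

section NonDivisorialLaw

variable {k : Type} [Field k]

/-! ## §108 (g34 · NEW · KERNEL) THE WHOLE-KIND KILL «NO NON-DIVISORIAL THREEFOLD TOWER» (and, §109–§110, THE CUT OF CELL D)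

THE LAW (`noTower_nonDivisorial_threefold`; every `p`, every field, EVERY class `P`, every weight `n ≥ 1`;
hypothesis-free): NO forced
threefold tower is NON-DIVISORIAL — i.e. in every infinite forced tower of marked ring dimension 3 SOME marked stalk
ideal `(𝓘_m)_{x_m}`
has a principal factor of positive weight (a divisorial component of `V(𝓘_m)` passes through `x_m`).  Proof = the
three kernels of
this file and LAW C by name: by Step A (§107, contrapositive) no codimension-one point of `V(𝓘_0)` generizes to
`x_0`; by Step B some
root open `U₀ ∋ x_0` has `V(𝓘_0|U₀)` of codimension ≥ 2; the RESTRICTED tower `T|U₀` (§105) is a forced threefold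
tower over the same
field with the same weight and empty boundary whose root support has codimension ≥ 2, hence (PERSISTENCE, §106) it
is CURVE-LIKE at
every stage — and LAW C (`noTower_threefold_curveLike`, g32) says there is no such tower.

THE CUT.  CELL D of g33 («occult non-divisorial», `NoWildOccultNonDivisorialMixedTowers`) splits EXACTLY (excluded
middle on the letter
`ThreefoldTower`) into D₃ = D ∩ (ring dimension 3) — DECIDED: EMPTY IN KERNEL by the law (its letters-inhabitant (O2)
`(x - 1)·(y³ + x³u², u⁴, yu³)` over `𝔽₃` of g33 §104 is of ring dimension 3: VACATED) — and D₄ = D ∩ (NOT of ring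
dimension 3) — UNDECIDED,
the occult non-divisorial tower with a marked local ring of dimension ≠ 3 (inside the mixed residual: the
ring-dimension-4 column,
beside CELL B), honestly tagged EXPECTED-HABITAT rd 4, no certified inhabitant on record.  EXACT HYPOTHESIS-FREE
RE-LOCATION: the g32
residual `R32 ⟺ B ∧ C ∧ D₄`, the g33 occult residual `C ∧ D ⟺ C ∧ D₄`; mod 31571 `R32 ⟺ C ∧ D₄`; the tree aside 28338
`NoWildContactFreeOffLocusTowers ⟺ C ∧ D₄` given 31571 and the surface port.  LOCATED RESIDUAL of the lens-4 NP
column after g34 =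
CELL C (occult divisorial; inhabited by (O1)) ∧ CELL D₄ (occult non-divisorial, NOT rd 3). -/

/-- **THE LAW «NO NON-DIVISORIAL THREEFOLD TOWER» (KERNEL, PROVED; every `p`, every field, every class `P`, every
weight `n ≥ 1`).**
[folklore] -/
theorem noTower_nonDivisorial_threefold {n : ℕ} (hn : 1 ≤ n) (P : ForcedTower → Prop) :
    NoTower n fun T => P T ∧ ThreefoldTower T ∧ ¬ DivisorialTower T := by
  intro p hp K _ _ T g hB hD hE hT
  obtain ⟨-, h3, hnd⟩ := hT
  have hN : ∀ i, IsLocallyNoetherian (T.St i) := fun i => (tower_isLocallyNoetherian_isRegular T g hB i).1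
  obtain ⟨U₀, h0, hU₀⟩ :=
    exists_rootOpens_one_lt_coheight T g hB hD (fun ζ hζ hsp => coheight_ne_one_of_not_divisorialTower T g hB hD hnd 0 hζ hsp)
  exact noTower_threefold_curveLike hn (fun _ => True) p hp K (towerRestrict T hN U₀ h0) (U₀.ι ≫ g)
    (towerRestrict_isBase T hN U₀ h0 g hB) (towerRestrict_isDatum T hN U₀ h0 hD) (towerRestrict_boundary T hN U₀ h0 hE)
    ⟨trivial, towerRestrict_threefoldTower T hN U₀ h0 h3,
      curveLikeTower_of_root (towerRestrict T hN U₀ h0) (U₀.ι ≫ g) (towerRestrict_isBase T hN U₀ h0 g hB)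
        (towerRestrict_isDatum T hN U₀ h0 hD) hU₀⟩

/-- **the law, positive form: EVERY FORCED THREEFOLD TOWER IS DIVISORIAL** — some marked stalk ideal has a principal
factor of positive
weight. [folklore] -/
theorem divisorialTower_of_threefoldTower {n : ℕ} (hn : 1 ≤ n) {p : ℕ} (hp : p.Prime) [CharP k p] (T : ForcedTower)
    (g : T.St 0 ⟶ Spec (.of k)) (hB : IsBase (T.St 0) g) (hD : IsDatum n (T.D 0)) (hE : (T.D 0).boundary = [])
    (h3 : ThreefoldTower T) : DivisorialTower T :=
  Classical.by_contradiction fun hnd => noTower_nonDivisorial_threefold hn (fun _ => True) p hp k T g hB hD hE ⟨trivial, h3, hnd⟩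

/-- the law in the WILD column. [folklore] -/
theorem noTowerWild_nonDivisorial_threefold {n : ℕ} (hn : 1 ≤ n) (P : ForcedTower → Prop) :
    NoTowerWild n fun T => P T ∧ ThreefoldTower T ∧ ¬ DivisorialTower T :=
  noTowerWild_of_noTower (noTower_nonDivisorial_threefold hn P)

/-- **THE PRICED NAME (CRITIC row 191 (NP-R)): NO WILD OCCULT NON-DIVISORIAL THREEFOLD TOWER** — delivered for EVERY class `P`
(the singular-class and occult letters are not needed): CELL D ∩ rd 3 is EMPTY IN KERNEL. [folklore] -/
theorem noTowerWild_occultNonDivisorial_threefold {n : ℕ} (hn : 1 ≤ n) (P : ForcedTower → Prop) :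
    NoTowerWild n fun T => P T ∧ ThreefoldTower T ∧ ¬ DivisorialTower T :=
  noTowerWild_nonDivisorial_threefold hn P

end NonDivisorialLaw

end Summit.ResolutionOfSingularities.ResolutionOfSingularities.Theorems.HugValuationCut
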